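import Summits.BirchSwinnertonDyer.BirchSwinnertonDyer.Theorems.SchneiderFreeAdditiveX3ArtinLinkGenusDoor
import HarnessLib

/-!
# Route `SchneiderFreeAdditiveX3` (K1 door), crux `PotMultBranchIMC` (stmt-BirchSwinnertonDyer-19176):
# the Artin link on the (M) road from the PARTNER's Heegner data (`N_V` Heegner + `p` split), no frame

Cell `bsd-schneider-ideate`, seat `bsd-schneider-door-c4` (prover, generation 8). HONEST FRAMING:
theorems only; the crux stays OPEN; BSD not advanced. Door-c2's (M) value road
(`…PotMultRebaseGenusField.lean`, `…PotMultReadHyps.lean`) carries the Artin link `hArtin` quantified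
WITHOUT the anticyclotomic frame: its curve-side data are `V` (multiplicative at `p`, `p ∥ N_V`),
`K` Heegner for `N_V` and `p` split in `K`. `artinLink_genus_door` (`…ArtinLinkGenusDoor.lean`) asks
instead for Heegner for `N_W` and a degree-one prime over `p`; this file derives those from the
partner's data: away from `p` the conductor exponents of `W = C • (V ⊗ χ_{p*})` and `V` agree
(tree `conductorExponent_eq_of_twist_pStar_of_ne` + `factorization_conductorNorm`), so every prime of
`N_W` is `p` or a prime of `N_V`, hence split; and a split `p` has a degree-one prime (tree
`X11b.exists_degreeOnePrime_of_splitsIn`). [cite: GrossLMS1991, §1 (Heegner hypothesis)]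
-/

noncomputable section

open scoped NumberField Classical
open Field IsDedekindDomain NumberField
open Literature.NumberTheory.EllipticCurves.ModularForms

-- D-0017 layout: summit = sub-problem, so `Summit.BirchSwinnertonDyer.BirchSwinnertonDyer.…` is the
-- mandated namespace (same option as the route's sockets files).
set_option linter.dupNamespace false
set_option autoImplicit false

namespace Summit.BirchSwinnertonDyer.BirchSwinnertonDyer.Theorems.SchneiderFree

open Literature.NumberTheory.EllipticCurves Literature.NumberTheory.EllipticCurves.CaiShuTian2014
  Literature.NumberTheory.EllipticCurves.Rank1Residual Rat.HeightOneSpectrum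

/-- **Heegner for `N_W` from Heegner for `N_V` and `p` split.** For `W = C • (V ⊗ χ_{p*})` (`p` odd,
`V`, `W` elliptic): every prime `ℓ ∣ N_W` is `p` or divides `N_V` (conductor exponents agree away
from `p`), so if every prime of `N_V` splits in `K` and `p` splits, every prime of `N_W` splits.
[cite: GrossLMS1991, §1 (Heegner hypothesis)] [cite: SilvermanAEC2009, App. C §16 (conductor)] -/
theorem satisfiesHeegnerHypothesis_of_twist_pStar {p : ℕ} [Fact p.Prime] (hp2 : p ≠ 2)
    (V W : WeierstrassCurve ℚ) [V.IsElliptic] [W.IsElliptic] (Ctw : WeierstrassCurve.VariableChange ℚ)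
    (hC : Ctw • V.quadraticTwist ((-1 : ℚ) ^ (p / 2) * p) = W)
    (K : Type) [Field K] (hHeV : SatisfiesHeegnerHypothesis (V.conductorNorm ℤ) K)
    (hsplit : ((Ideal.span {(p : ℤ)}).primesOver (𝓞 K)).ncard = 2) :
    SatisfiesHeegnerHypothesis (W.conductorNorm ℤ) K := by
  intro ℓ hℓ hℓW
  by_cases hℓp : ℓ = p
  · subst hℓp; exact hsplit
  · haveI : Fact ℓ.Prime := ⟨hℓ⟩
    have hfacW := W.factorization_conductorNorm_holds
      (Summit.BirchSwinnertonDyer.Rank1Residual.Additive.placeOf ℓ)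
    have hfacV := V.factorization_conductorNorm_holds
      (Summit.BirchSwinnertonDyer.Rank1Residual.Additive.placeOf ℓ)
    rw [Summit.BirchSwinnertonDyer.Rank1Residual.Additive.natGenerator_placeOf_eq] at hfacW hfacV
    have hexp := Summit.BirchSwinnertonDyer.Rank1Residual.Additive.conductorExponent_eq_of_twist_pStar_of_ne
      p hp2 V W Ctw hC (Summit.BirchSwinnertonDyer.Rank1Residual.Additive.placeOf ℓ)
      (by rw [Summit.BirchSwinnertonDyer.Rank1Residual.Additive.natGenerator_placeOf_eq]; exact hℓp)
    have hℓV : ℓ ∣ V.conductorNorm ℤ := by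
      rw [hℓ.dvd_iff_one_le_factorization (V.conductorNorm_pos_holds).ne', hfacV, ← hexp, ← hfacW,
        ← hℓ.dvd_iff_one_le_factorization (W.conductorNorm_pos_holds).ne']
      exact hℓW
    exact hHeV ℓ hℓ hℓV

/-- **THE ARTIN LINK ON THE (M) ROAD, partner-data form.** As `artinLink_genus_door`, but with the
frame-free hypotheses of door-c2's `PotMultRead.ArtinGenusM` / `…_of_thm15_of_facts`: `K` Heegner for
`N_V` and `p` SPLIT in `K` (instead of Heegner for `N_W` and a degree-one `𝔭 ∋ p`), plus `p` odd,
`W = C₂ • ((D • V) ⊗ χ_{p*})` globally minimal with `Addv W p`, the genus datum and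
`hasEntireLFunction_rat`. On the (M) cell these binders are exactly those of
`exists_partner_roadData_of_subM` (door-c2 g8). [cite: Gross2004, §2 p. 40]
[cite: IrelandRosen1990, Ch. 20 §5 Prop. 20.5.4(b)] -/
theorem artinLink_genus_door_of_split {p : ℕ} [Fact p.Prime] (hp2 : p ≠ 2)
    (V : WeierstrassCurve ℚ) [V.IsElliptic] [V.IsGloballyMinimal] [NeZero (V.conductorNorm ℤ)]
    (D C₂ : WeierstrassCurve.VariableChange ℚ)
    [(C₂ • (D • V).quadraticTwist ((-1 : ℚ) ^ (p / 2) * p)).IsElliptic]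
    [(C₂ • (D • V).quadraticTwist ((-1 : ℚ) ^ (p / 2) * p)).IsGloballyMinimal]
    (hadd : Addv (C₂ • (D • V).quadraticTwist ((-1 : ℚ) ^ (p / 2) * p)) p)
    (K : Type) [Field K] [NumberField K] (hK : IsImaginaryQuadratic K)
    (hHeV : SatisfiesHeegnerHypothesis (V.conductorNorm ℤ) K)
    (hsplit : ((Ideal.span {(p : ℤ)}).primesOver (𝓞 K)).ncard = 2)
    (ιc : K →+* ℂ) (DtV : ModularParametrizationData V (V.conductorNorm ℤ))
    (χ : ringClassGal ιc p →* ℂˣ) (χgal : absoluteGaloisGroup K →ₜ* ℂˣ)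
    (emb : ringClassField K ιc p →+* AlgebraicClosure K) (hinfl : IsInflationAlong ιc p emb χ χgal)
    (s : ringClassGal ιc p → ℤˣ) (hχ : ∀ σ, ((χ σ : ℂˣ) : ℂ) = ((s σ : ℤ) : ℂ))
    (θ : ringClassField K ιc p)
    (hθ2 : θ ^ 2 = algebraMap ℚ (ringClassField K ιc p) ((-1 : ℚ) ^ (p / 2) * p))
    (hθσ : ∀ σ : ringClassGal ιc p, σ.1 θ = ((s σ : ℤ) : ringClassField K ιc p) * θ)
    (hmod : WeierstrassCurve.hasEntireLFunction_rat) :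
    rankinSelbergDerivValue DtV.f χgal 1 =
      LDerivEK (C₂ • (D • V).quadraticTwist ((-1 : ℚ) ^ (p / 2) * p)) K := by
  have hp : p.Prime := Fact.out
  set W := C₂ • (D • V).quadraticTwist ((-1 : ℚ) ^ (p / 2) * p) with hWdef
  -- `θ ≠ 0`
  have hθ : θ ≠ 0 := by
    intro h0
    rw [h0, zero_pow two_ne_zero, eq_comm, map_eq_zero] at hθ2
    exact mul_ne_zero (pow_ne_zero _ (by norm_num)) (by exact_mod_cast hp.ne_zero) hθ2
  -- Heegner for `N_W`
  have hCtw : (C₂ * ⟨D.u, ((-1 : ℚ) ^ (p / 2) * p) * D.r, 0, 0⟩) •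
      V.quadraticTwist ((-1 : ℚ) ^ (p / 2) * p) = W := by
    rw [hWdef, mul_smul, ← WeierstrassCurve.quadraticTwist_smul]
  have hHeW : SatisfiesHeegnerHypothesis (W.conductorNorm ℤ) K :=
    satisfiesHeegnerHypothesis_of_twist_pStar hp2 V W _ hCtw K hHeV hsplit
  -- a degree-one prime of `K` over the split `p`
  obtain ⟨𝔭, h𝔭, he, -⟩ :=
    Summit.BirchSwinnertonDyer.Rank1Residual.X11b.exists_degreeOnePrime_of_splitsIn K p hK.1 hsplit
  exact artinLink_genus_door hp2 V D C₂ hadd K hK hHeW h𝔭 he ιc DtV χ χgal emb hinfl s hχ θ hθ2 hθ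
    hθσ hmod

end Summit.BirchSwinnertonDyer.BirchSwinnertonDyer.Theorems.SchneiderFree

end
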